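import Literature.AlgebraicGeometry.AbelianVarieties.HomogeneousLineBundleFieldChange
import Literature.AlgebraicGeometry.Modules.RankOneModuleDivisorDictionary
import Literature.AlgebraicGeometry.Modules.DetClassOfIso
import Literature.AlgebraicGeometry.Modules.PullbackFrame
import HarnessLib

/-!
# Rank-one modules on an abelian variety which become isomorphic over an extension field are isomorphic
# (`Pic(A) ↪ Pic(A_σ)` in module currency; [GortzWedhorn2023] Thm. 24.66 (1))

Layer `Literature/AlgebraicGeometry/AbelianVarieties`, namespace `Literature.AlgebraicGeometry.AbelianVarieties`.  THEOREMS ONLY (no definition, no named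
fact, no instance, no notation).  For an abelian variety `A` over a field `k`, a field extension `σ : k → L` with projection `π : A_σ → A`
(`A_σ = A ×_k Spec L`, ★ `baseChangeAlong`), and rank-one modules `M`, `N` on `A`:

* **`nonempty_iso_of_nonempty_iso_pullback_baseChangeAlongFst`** — `π^*M ≅ π^*N ⟹ M ≅ N`: `[M]·[N]⁻¹ = [𝒪(D)]` (★ `CechPic.exists_cechClass_eq`), `π^*[𝒪(D)] = 1`
  gives `π^*D ∼ 0` hence `D ∼ 0` (★ «`Pic(A) ↪ Pic(A_σ)`» `CartierDivisor.linEquiv_zero_of_classPullback_baseChangeAlongFst`), so `[M] = [N]` and rank-one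
  modules with equal determinant classes are isomorphic (★ `nonempty_iso_iff_detClass_eq`); `…_baseChangeFst` — the `Algebra k L` spelling.

Purpose (cell `hodgecm-mathlib`, F-3 (Mc) spine, N3′ step S-f «descent `κ̄ → κ(t)` of the level-0 graph point»): generic input (D3).  HC_CM is proved only
modulo the 7 printed citations until rung 0 closes; nothing here bears on a summit statement.

## References
* [GortzWedhorn2023] U. Görtz, T. Wedhorn, *Algebraic Geometry II* (2023), Lemma 24.65 (p. 405) and Thm. 24.66 (1) (p. 405).
* [Hartshorne1977] R. Hartshorne, *Algebraic Geometry* (1977), II Prop. 6.15 and Ex. 6.8 (a) (`Ȟ¹(𝒪^×) = CaCl`, functoriality).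
-/

set_option autoImplicit false

noncomputable section

open CategoryTheory CategoryTheory.Limits AlgebraicGeometry

universe u

namespace Literature.AlgebraicGeometry.AbelianVarieties

open Literature.AlgebraicGeometry.Motives Literature.AlgebraicGeometry.Modules

variable {k L : Type u} [Field k] [Field L] (σ : k →+* L) (A : AbelianVariety k)
  (π : (A.baseChangeAlong σ).X.left ⟶ A.X.left) (hπ : π = baseChangeHomFst σ A.X)

include hπ in
/-- **`π^*M ≅ π^*N ⟹ M ≅ N` for rank-one modules on an abelian variety** along the base change `π : A_σ → A` to an extension field
(injectivity of `Pic(A) → Pic(A_σ)`, [GortzWedhorn2023] Thm. 24.66 (1), in module currency).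
[cite: GortzWedhorn2023, Lemma 24.65 (p. 405) and Thm. 24.66 (1) (p. 405)] [cite: Hartshorne1977, II Prop. 6.15] -/
theorem nonempty_iso_of_nonempty_iso_pullback_baseChangeAlongFst [IsDominant π] {M N : A.X.left.Modules}
    (hM : HasRank M 1) (hN : HasRank N 1)
    (h : Nonempty ((Scheme.Modules.pullback π).obj M ≅ (Scheme.Modules.pullback π).obj N)) : Nonempty (M ≅ N) := by
  have hMf := HasRank.isFiniteLocallyFree' hM
  have hNf := HasRank.isFiniteLocallyFree' hN
  -- the classes agree after pull-back
  have h1 : detClass (hMf.pullback π) = detClass (hNf.pullback π) :=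
    (nonempty_iso_iff_detClass_eq (hasRank_pullback _ hM) (hasRank_pullback _ hN) _ _).1 h
  rw [detClass_pullback _ hMf, detClass_pullback _ hNf] at h1
  -- `[M]·[N]⁻¹ = [𝒪(D)]` with `π^*D ∼ 0`, hence `D ∼ 0`
  obtain ⟨D, hD⟩ := CechPic.exists_cechClass_eq (detClass hMf * (detClass hNf)⁻¹)
  have h2 : (D.pullback π).LinEquiv 0 := by
    rw [← CartierDivisor.cechClass_eq_iff_linEquiv, CartierDivisor.cechClass_pullback, hD, map_mul, map_inv, h1,
      mul_inv_cancel, CartierDivisor.cechClass_zero]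
  have h3 : D.LinEquiv 0 :=
    linEquiv_zero_of_classPullback_baseChangeAlongFst σ A π hπ D
      ((CartierDivisor.classPullback_linEquiv_pullback π D).trans h2)
  have h4 : detClass hMf = detClass hNf := by
    have e : detClass hMf * (detClass hNf)⁻¹ = 1 := by
      rw [← hD, (CartierDivisor.cechClass_eq_iff_linEquiv _ _).2 h3, CartierDivisor.cechClass_zero]
    exact mul_inv_eq_one.mp e
  exact (nonempty_iso_iff_detClass_eq hM hN hMf hNf).2 h4

/-- **The same along `A ⊗_k L → A` for an algebra `L ⊇ k`** (`π = pullback.fst A.X.hom (bcSpec k L)`).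
[cite: GortzWedhorn2023, Thm. 24.66 (1) (p. 405)] -/
theorem nonempty_iso_of_nonempty_iso_pullback_baseChangeFst {k : Type u} [Field k] (L : Type u) [Field L] [Algebra k L]
    (A : AbelianVariety k) (π : (A.baseChange L).X.left ⟶ A.X.left)
    (hπ : π = pullback.fst A.X.hom (AbelianVariety.bcSpec k L)) [IsDominant π]
    {M N : A.X.left.Modules} (hM : HasRank M 1) (hN : HasRank N 1)
    (h : Nonempty ((Scheme.Modules.pullback π).obj M ≅ (Scheme.Modules.pullback π).obj N)) : Nonempty (M ≅ N) := by
  haveI : @IsDominant (A.baseChangeAlong (algebraMap k L)).X.left A.X.left π := ‹IsDominant π›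
  exact nonempty_iso_of_nonempty_iso_pullback_baseChangeAlongFst (algebraMap k L) A π hπ hM hN h

end Literature.AlgebraicGeometry.AbelianVarieties

end
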